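import Summits.ValiantsHypothesis.ValiantsHypothesis.Theses.SOSTau

/-!
# Negative lemma around crux `SOSTau` (route SOSTau, item stmt-ValiantsHypothesis-18748):
# REALNESS is load-bearing

Crux-disprover artefact (cdisprove cycle 1).  It does not refute `SOSTau`; it pins down that the
restriction to REAL zeros of REAL representations is load-bearing:

* `sosTau_false_over_complex` — the verbatim complex analogue of `SOSTau` (complex weights,
  complex sparse polynomials, distinct COMPLEX zeros) is false: `X^(2c+2) − 1 = 1·(X^(c+1))² +
  (−1)·1²` has support-sum `2` and `2c+2` distinct complex zeros (the `(2c+2)`-th roots of unity),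
  while only `±1` are real.  So any proof of the crux must use an argument that sees the real
  line (sign changes / Rolle / real-rootedness), not merely the algebra of sparse squares.

Companion file: `LoadBearing.lean` (multiplicity counting false; constant `≠ 0`).
-/

set_option linter.dupNamespace false

namespace Summit.ValiantsHypothesis.ValiantsHypothesis.Theorems.SOSTau.Negative

open Polynomial

/-- The complex analogue of `SOSTau` is FALSE.  Witness for a purported constant `c`: `s = 2`,
`a = (1, −1)`, `g = (X^(c+1), 1)`; then `f = X^(2c+2) − 1` has `2c+2 > c·2` distinct complex
zeros. [folklore] -/
theorem sosTau_false_over_complex :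
    ¬ ∃ c : ℕ, ∀ (s : ℕ) (a : Fin s → ℂ) (g : Fin s → Polynomial ℂ),
      (∑ i, Polynomial.C (a i) * g i ^ 2).roots.toFinset.card ≤ c * ∑ i, (g i).support.card := by
  rintro ⟨c, hc⟩
  have h := hc 2 ![1, -1] ![X ^ (c + 1), 1]
  have hf : (∑ i : Fin 2, Polynomial.C ((![1, -1] : Fin 2 → ℂ) i) *
      (![X ^ (c + 1), 1] : Fin 2 → ℂ[X]) i ^ 2) = X ^ (2 * c + 2) - C 1 := by
    simp only [Fin.sum_univ_two, Matrix.cons_val_zero, Matrix.cons_val_one, map_one, one_mul,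
      one_pow, map_neg, mul_one, ← pow_mul]
    ring_nf
  have hS : (∑ i : Fin 2, ((![X ^ (c + 1), 1] : Fin 2 → ℂ[X]) i).support.card) = 2 := by
    simp only [Fin.sum_univ_two, Matrix.cons_val_zero, Matrix.cons_val_one]
    rw [Polynomial.support_X_pow, ← Polynomial.C_1, Polynomial.support_C (one_ne_zero)]
    simp
  rw [hf, hS] at h
  have hroots : (X ^ (2 * c + 2) - C (1 : ℂ)).roots.toFinset.card = 2 * c + 2 := by
    classical
    have := IsPrimitiveRoot.card_nthRootsFinset
      (Complex.isPrimitiveRoot_exp (2 * c + 2) (by omega))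
    rwa [Polynomial.nthRootsFinset_def] at this
  rw [hroots] at h
  omega

end Summit.ValiantsHypothesis.ValiantsHypothesis.Theorems.SOSTau.Negative
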